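import Mathlib
import HarnessLib
import Summits.ResolutionOfSingularities.ResolutionOfSingularities.Theorems.WildQuotientsWildQuotientResolutionS1aKillFreeKN
import Summits.ResolutionOfSingularities.ResolutionOfSingularities.Theorems.WildQuotientsWildQuotientResolutionS1aKillCertCoverEq

/-!
# S1a — K-FREE FRAME: the (KN) node from AGREEING PRINCIPAL-CENTRE CHARTS (`treeF_one_of_agreeingCharts`)

[OURS · L1 W4.5c · lead-1 g11; A-KF v0 §2 «root (KN) = K-LEAST glue», ASSIGNMENT v10.34 «first depth-1 (KN) instance»] — NOT statements of the manuscript;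
counted 0; AI-level work, weaker than expert review. Crux stmt-ResolutionOfSingularities-17941 `CyclicQuotientFourfolds`, line `s1a-logminvertex` v12
(`stub_reachLowerInF`).

The K-assembly of gens 8–10 (`KillGlue.exists_isPrincipalCentre_of_agree_filtration_eq`, p643066-lineage: finitely many principal-centre charts `(Oᵢ, 𝒦ᵢ)` of
one degree `d > 0` whose filtrations AGREE on the overlaps and whose supports lie in a closed `B ⊆ ⋃ Oᵢ` glue to ONE principal centre `J` with `J|Oᵢ = 𝒦ᵢ|Oᵢ`)
feeds `treeF_one_of_namedKill` (p656845): the designated kill charts are the `Oᵢ` themselves, and the touching point is read in the producer's OWN chart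
(`x ∈ V((𝒦ᵢ|Oᵢ)_d)` ⇒ `x ∈ supp J_d`, `IdealSheafData.mem_support_iff_of_mem`). No badness hypothesis (`B ⊆ badLocus` of the typed K-assembly is gone), no
agreement beyond the producer's own charts, no K.

* `mem_support_of_mem_zeroLocus_filtration` — a point of `V((J|O)_d)` lies in `supp J_d`;
* ★★★ `treeF_one_of_agreeingCharts` — THE ROOT (KN) NODE OF THE CENSUS RECIPES IS KERNEL: agreeing principal-centre charts covering a closed `B`, one of which
  vanishes (in degree `d`) at a point of a TOP component of `F_𝔄`, give a depth-1 `TreeF` node reaching `μ_F`-lower decorated models, for every class `P`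
  accepting the decorations of the realisations of the glued centre with formal locus `π′⁻¹(F_𝔄 ∖ ⋃ Oᵢ)`.
-/

set_option linter.dupNamespace false

noncomputable section

open CategoryTheory Limits AlgebraicGeometry TopologicalSpace Topology
open Literature.AlgebraicGeometry.Resolution Literature.AlgebraicGeometry.RelativeSpec
open Summit.ResolutionOfSingularities.ResolutionOfSingularities.Theorems.WildQuotientResolution.S1
open Summit.ResolutionOfSingularities.ResolutionOfSingularities.Theorems.WildQuotientResolution.S1.NodeAtlas
open Summit.ResolutionOfSingularities.ResolutionOfSingularities.Theorems.WildQuotientResolution.S1.NpFrame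
open Summit.ResolutionOfSingularities.ResolutionOfSingularities.Theorems.WildQuotientResolution.S1.KillGlue

namespace Summit.ResolutionOfSingularities.ResolutionOfSingularities.Theorems.WildQuotientResolution.S1.GameFrame.GModel

variable {p : ℕ} {X' X₁ : Scheme.{0}} {q : X' ⟶ X₁} {G : Type} [Group G] {ρ : G →* Aut X'} {g₀ : G}

/-- A point of the zero locus of the degree-`d` piece of a Rees filtration on an affine chart lies in the support of its degree-`d` ideal sheaf. -/
theorem mem_support_of_mem_zeroLocus_filtration (M : GModel p q G ρ g₀) (J : ReesFiltration M.V) (U : M.V.affineOpens) (d : ℕ) {x : M.V}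
    (hxU : x ∈ U.1) (hx : x ∈ M.V.zeroLocus (U := U.1) (((J.filtration U).ideal d : Ideal Γ(M.V, U.1)) : Set Γ(M.V, U.1))) :
    x ∈ ((J.ideal d).support : Set M.V) :=
  (Scheme.IdealSheafData.mem_support_iff_of_mem hxU).mpr hx

/-- ★★★ **THE ROOT (KN) NODE FROM AGREEING PRINCIPAL-CENTRE CHARTS.** At a decorated model `(M, 𝔄)` (compact, separated, Noetherian base, `dim F_𝔄 < n`):
finitely many principal-centre charts `(Oᵢ, 𝒦ᵢ)` of one degree `d > 0`, agreeing on overlaps, with supports inside a closed `B ⊆ ⋃ Oᵢ`, ONE of which vanishes in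
degree `d` at a point of a TOP-dimensional component `t` of `F_𝔄`; and a class `P` accepting, for every principal centre `J` with `J|Oᵢ = 𝒦ᵢ|Oᵢ`, every
decoration of every realisation of `J` whose formal locus is `π′⁻¹(F_𝔄 ∖ ⋃ Oᵢ)`. Then `TreeF P (LexLTF · · M 𝔄) 1 M 𝔄`. [OURS · L1 W4.5c · A-KF v0 (KN) root] -/
theorem treeF_one_of_agreeingCharts {P : ∀ N : GModel p q G ρ g₀, NodeAtlasData p N.act g₀ → Prop} [Finite G] (hp : p.Prime)
    (hG : ∀ g : G, g ∈ Subgroup.zpowers g₀) (M : GModel p q G ρ g₀) [CompactSpace M.V] [M.V.IsSeparated] (hB : M.HasNoetherianBase)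
    (𝔄 : NodeAtlasData p M.act g₀) {n : ℕ} (hdim : M.fdim 𝔄 < n)
    {ι : Type} [Finite ι] (O : ι → M.act.StableAffineOpens) (hO : ∀ i, IsAffineOpen (O i).1) (𝒦 : ι → ReesFiltration M.V) {d : ℕ} (hd : 0 < d)
    (hprin : ∀ i, IsPrincipalCentreChart p M.act g₀ (𝒦 i) d (O i))
    (hagree : ∀ i k (U : M.V.affineOpens), U.1 ≤ (O i).1 → U.1 ≤ (O k).1 → ∀ m, ((𝒦 i).filtration U).ideal m = ((𝒦 k).filtration U).ideal m)
    {Bset : Set M.V} (hBc : IsClosed Bset) (hBcov : Bset ⊆ ⋃ i, ((O i).1 : Set M.V))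
    (hsupp : ∀ i, (((𝒦 i).ideal d).support : Set M.V) ∩ (O i).1 ⊆ Bset)
    {t : Set ↥𝔄.fLocus} (ht : t ∈ irreducibleComponents ↥𝔄.fLocus) (hdt : topologicalKrullDim ↥t = M.fdim 𝔄)
    (htouch : ∃ x ∈ t, ∃ i, (x : M.V) ∈ (O i).1 ∧
      (x : M.V) ∈ M.V.zeroLocus (U := (O i).1) ((((𝒦 i).filtration ⟨(O i).1, hO i⟩).ideal d : Ideal Γ(M.V, (O i).1)) : Set Γ(M.V, (O i).1)))
    (hP : ∀ J : ReesFiltration M.V, IsPrincipalCentre p M.act g₀ J d →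
      (∀ i m, (J.filtration ⟨(O i).1, hO i⟩).ideal m = ((𝒦 i).filtration ⟨(O i).1, hO i⟩).ideal m) →
      ∀ (M' : GModel p q G ρ g₀) (π' : M'.V ⟶ M.V), IsBlowup π' (J.ideal d) → M'.π = π' ≫ M.π → M'.r = π' ≫ M.r →
      (∀ g : G, (M'.act.aut g).hom ≫ π' = π' ≫ (M.act.aut g).hom) →
      ∀ 𝔄' : NodeAtlasData p M'.act g₀,
        (∀ v' : M'.V, v' ∈ 𝔄'.fLocus ↔ π'.base v' ∉ (⋃ i, ((O i).1 : Set M.V)) ∧ π'.base v' ∈ 𝔄.fLocus) → P M' 𝔄') :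
    TreeF P (fun N 𝔅 => LexLTF N 𝔅 M 𝔄) 1 M 𝔄 := by
  obtain ⟨J, hJ, hJB, hJO, hJeq⟩ := exists_isPrincipalCentre_of_agree_filtration_eq hG M O hO 𝒦 hd hprin hagree hBc hBcov hsupp
  obtain ⟨x, hxt, i, hxi, hxZ⟩ := htouch
  refine treeF_one_of_namedKill hp hG M hB 𝔄 hdim J d hJ O hJO (hJB.trans hBcov) ht hdt ⟨x, hxt, ?_⟩ (hP J hJ hJeq)
  refine M.mem_support_of_mem_zeroLocus_filtration J ⟨(O i).1, hO i⟩ d hxi ?_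
  rw [hJeq i d]
  exact hxZ

end Summit.ResolutionOfSingularities.ResolutionOfSingularities.Theorems.WildQuotientResolution.S1.GameFrame.GModel

end
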